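import Mathlib
import Summits.KontsevichZagierPeriods.Zeta5Search.LaiGrowthCenter
import HarnessLib

/-!
# ζ(5) search — growth side of Lai's box function, part 3: the centre size is a ratio of factorials
# (fam-indep, κ₃ ladder: the `growth` / `β` input, step 3)

HONEST FRAMING: systematic search; no irrationality claim unless certified.

OUR work (Summit side; cell `pub-zeta5`, family `indep`, planner seat gen 4, STAGED for the lane). We evaluate / bound the
centre size `laiGAbs(k)` of `LaiGrowthCenter.lean` UNIFORMLY in the pole index `0 ≤ k ≤ Mn`:
* block factors: `recipRegAbs(a, m, k) = C(m−1, k−a)` for `a ≤ k < a+m` (`recipRegAbs_eq_choose`), `≤ 1` otherwise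
  (`recipRegAbs_le_one`), hence `≤ 2^{m−1}` always (`recipRegAbs_le_two_pow`) — Lai's `((M−2δ_j)n)!/|(z+δ_j n)_{(M−2δ_j)n+1}|
  ≤ … 2^{(M−2δ_j)n}` ([Lai2024BallRivoal, p. 20]) at the centre of the circle;
* numerator factors: `∏_q |polyBrick(−rn+qn,n)(−k)| = ∏_{i<rn}(k+i+1)/n!^r`, `∏_q |polyBrick(Mn+1+qn,n)(−k)| =
  ∏_{i<rn}(Mn−k+i+1)/n!^r` (`prod_abs_polyBrick_left/right`), and the AM–GM pairing
  `(k+i+1)(Mn−k+i+1) ≤ ((Mn+2i+2)/2)²` ([Lai2024BallRivoal, (5.16)]) (`prod_numerators_le_central`);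
* together: **`laiGAbs(k) ≤ laiGAbsBound := (Mn+2) · ∏_{i<rn} ((Mn+2i+2)/2)² / n!^{2r} · ∏_j 2^{(M−2δ_j)n}`**, free of `k`
  (`laiGAbs_le`), and for even `M = 2M'` the central product is `((M'n+rn)!/(M'n)!)²` (`prod_central_two_mul`), so
  `(1/n) log laiGAbsBound → (2r+M) log((2r+M)/2) − M log(M/2) + log 2 · Σ_j (M−2δ_j) = β̃` ([Lai2024BallRivoal, p. 49];
  the limit itself is successor work: Stirling via the tree's `BallRivoal.log_factorial_le` / `psi_le_log_factorial`).

References: [Lai2024BallRivoal, §5 (5.14)–(5.16), §13 p. 49]; [Zudilin2004, §7 Lemma 17 (the values `R(−k)`)].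
-/

open Finset Filter Literature.NumberTheory.Transcendental Literature.Analysis.Calculus
open scoped Nat Topology

namespace Summit.KontsevichZagierPeriods.Zeta5Search

noncomputable section

/-! ### The block factors `recipRegAbs` -/

/-- In the pole range the centre size is a binomial coefficient: `recipRegAbs a m k = C(m−1, k−a)` for `a ≤ k < a+m`.
[cite: Zudilin2004, §2 Lemma 3 (proof)] (our bookkeeping) -/
theorem recipRegAbs_eq_choose (a : ℤ) (m : ℕ) (k : ℤ) (h₁ : a ≤ k) (h₂ : k < a + m) :
    recipRegAbs a m k = (((m - 1).choose (k - a).toNat : ℕ) : ℚ) := by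
  set i := (k - a).toNat with hi
  have hik : (i : ℤ) = k - a := by rw [hi]; exact Int.toNat_of_nonneg (by omega)
  have him : i < m := by omega
  have hfilter : (range m).filter (fun l : ℕ => a + (l : ℤ) ≠ k) = (range m).erase i := by
    rw [← filter_ne']
    exact filter_congr fun l _ => by constructor <;> intro h <;> omega
  have hterm : ∀ l ∈ (range m).erase i, |-(k : ℚ) + ((a + (l : ℤ) : ℤ) : ℚ)|⁻¹ = |(l : ℚ) - i|⁻¹ := by
    intro l _
    have e : -(k : ℚ) + ((a + (l : ℤ) : ℤ) : ℚ) = (l : ℚ) - i := by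
      have h' : ((-(k : ℤ) + (a + l) : ℤ) : ℚ) = (((l : ℤ) - i : ℤ) : ℚ) := by congr 1; omega
      push_cast at h' ⊢; linarith
    rw [e]
  rw [recipRegAbs, hfilter, prod_congr rfl hterm, prod_inv_distrib, ← abs_prod, prod_erase_range_sub m i him,
    abs_mul, abs_mul, abs_pow, abs_neg, abs_one, one_pow, one_mul, Nat.abs_cast, Nat.abs_cast]
  have hch := Nat.choose_mul_factorial_mul_factorial (show i ≤ m - 1 by omega)
  have hi0 : (i ! : ℚ) ≠ 0 := by positivity
  have hmi0 : ((m - 1 - i)! : ℚ) ≠ 0 := by positivity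
  rw [eq_comm, eq_mul_inv_iff_mul_eq₀ (mul_ne_zero hi0 hmi0)]
  exact_mod_cast (by rw [← hch]; ring : ((m - 1).choose i : ℕ) * (i ! * (m - 1 - i)!) = (m - 1)!)

/-- Outside the pole range the centre size is `≤ 1`: `∏_{l<m} |a+l−k| ≥ m! ≥ (m−1)!`. [this file] -/
theorem recipRegAbs_le_one (a : ℤ) (m : ℕ) (k : ℤ) (h : ¬ (a ≤ k ∧ k < a + m)) : recipRegAbs a m k ≤ 1 := by
  have hfilter : (range m).filter (fun l : ℕ => a + (l : ℤ) ≠ k) = range m :=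
    filter_true_of_mem fun l hl => by have := mem_range.1 hl; omega
  -- `m! ≤ ∏ |a + l − k|`
  have hfact : ((m ! : ℕ) : ℚ) ≤ ∏ l ∈ range m, |-(k : ℚ) + ((a + (l : ℤ) : ℤ) : ℚ)| := by
    rcases not_and_or.1 h with hk | hk
    · rw [← prod_range_add_one_eq_factorial, Nat.cast_prod]
      refine prod_le_prod (fun _ _ => by positivity) fun l hl => ?_
      have hle : (((l + 1 : ℕ) : ℤ) : ℚ) ≤ ((a + l - k : ℤ) : ℚ) := by exact_mod_cast (by push_cast; omega)
      have heq : -(k : ℚ) + ((a + (l : ℤ) : ℤ) : ℚ) = ((a + l - k : ℤ) : ℚ) := by push_cast; ring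
      rw [heq]
      push_cast at hle ⊢
      rw [abs_of_pos (by linarith [(Nat.cast_nonneg l : (0:ℚ) ≤ l)])]
      exact hle
    · rw [← prod_range_add_one_eq_factorial, Nat.cast_prod, ← prod_range_reflect _ m]
      refine prod_le_prod (fun _ _ => by positivity) fun l hl => ?_
      have hl' := mem_range.1 hl
      have hle : (((m - 1 - l + 1 : ℕ) : ℤ) : ℚ) ≤ ((k - a - l : ℤ) : ℚ) := by exact_mod_cast (by push_cast; omega)
      have heq : -(k : ℚ) + ((a + (l : ℤ) : ℤ) : ℚ) = -((k - a - l : ℤ) : ℚ) := by push_cast; ring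
      rw [heq, abs_neg]
      have hpos : (0 : ℚ) < ((k - a - l : ℤ) : ℚ) := lt_of_lt_of_le (by positivity) hle
      rw [abs_of_pos hpos]
      exact hle
  have hpos : 0 < ∏ l ∈ range m, |-(k : ℚ) + ((a + (l : ℤ) : ℤ) : ℚ)| :=
    lt_of_lt_of_le (by positivity) hfact
  rw [recipRegAbs, hfilter, prod_inv_distrib, ← div_eq_mul_inv, div_le_one hpos]
  refine le_trans ?_ hfact
  exact_mod_cast Nat.factorial_le (Nat.sub_le m 1)

/-- **Uniform block bound**: `recipRegAbs a m k ≤ 2^{m−1}` for every integer `k`. [cite: Lai2024BallRivoal, §5 p. 20]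
(our centre version) -/
theorem recipRegAbs_le_two_pow (a : ℤ) (m : ℕ) (k : ℤ) : recipRegAbs a m k ≤ (2 : ℚ) ^ (m - 1) := by
  by_cases h : a ≤ k ∧ k < a + m
  · rw [recipRegAbs_eq_choose a m k h.1 h.2]
    exact_mod_cast Nat.choose_le_two_pow (m - 1) _
  · exact (recipRegAbs_le_one a m k h).trans (one_le_pow₀ (by norm_num))

/-! ### The numerator factors -/

/-- `∏_{q<r} |polyBrick(−rn+qn, n)(−k)| = ∏_{i<rn} (k+i+1) / n!^r`. [this file] -/
theorem prod_abs_polyBrick_left (r n k : ℕ) :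
    ∏ q ∈ range r, |polyBrick (-((r * n : ℕ) : ℤ) + ((q * n : ℕ) : ℤ)) n (-(k : ℚ))| =
      (∏ i ∈ range (r * n), ((k + i + 1 : ℕ) : ℚ)) / (n ! : ℚ) ^ r := by
  have h := prod_sub_eq_polyBricks r n (-(k : ℚ))
  have hn : ((n ! : ℚ)) ^ r ≠ 0 := by positivity
  rw [← abs_prod, eq_div_iff hn, mul_comm]
  have habs : |((n ! : ℚ)) ^ r| = (n ! : ℚ) ^ r := abs_of_pos (by positivity)
  rw [← habs, ← abs_mul, ← h, abs_prod]
  refine prod_congr rfl fun i _ => ?_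
  rw [abs_of_neg (by linarith [(Nat.cast_nonneg k : (0:ℚ) ≤ k), (Nat.cast_nonneg i : (0:ℚ) ≤ i)])]
  push_cast; ring

/-- `∏_{q<r} |polyBrick(Mn+1+qn, n)(−k)| = ∏_{i<rn} (Mn−k+i+1) / n!^r` for `k ≤ Mn`. [this file] -/
theorem prod_abs_polyBrick_right (r M n : ℕ) {k : ℕ} (hk : k ≤ M * n) :
    ∏ q ∈ range r, |polyBrick (((M * n + 1 + q * n : ℕ) : ℤ)) n (-(k : ℚ))| =
      (∏ i ∈ range (r * n), ((M * n - k + i + 1 : ℕ) : ℚ)) / (n ! : ℚ) ^ r := by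
  have h := prod_add_eq_polyBricks r M n (-(k : ℚ))
  have hn : ((n ! : ℚ)) ^ r ≠ 0 := by positivity
  rw [← abs_prod, eq_div_iff hn, mul_comm]
  have habs : |((n ! : ℚ)) ^ r| = (n ! : ℚ) ^ r := abs_of_pos (by positivity)
  rw [← habs, ← abs_mul, ← h, abs_prod]
  refine prod_congr rfl fun i _ => ?_
  have hk' : ((k : ℕ) : ℚ) ≤ ((M * n : ℕ) : ℚ) := by exact_mod_cast hk
  push_cast at hk'
  rw [abs_of_pos (by linarith [(Nat.cast_nonneg i : (0:ℚ) ≤ i)])]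
  push_cast [Nat.cast_sub hk]; ring

/-- **AM–GM pairing** ([Lai2024BallRivoal, (5.16)]): `∏_{i<rn}(k+i+1) · ∏_{i<rn}(Mn−k+i+1) ≤ ∏_{i<rn} ((Mn+2i+2)/2)²`.
[cite: Lai2024BallRivoal, §5 (5.16)] (our centre version) -/
theorem prod_numerators_le_central (r M n : ℕ) {k : ℕ} (hk : k ≤ M * n) :
    (∏ i ∈ range (r * n), ((k + i + 1 : ℕ) : ℚ)) * (∏ i ∈ range (r * n), ((M * n - k + i + 1 : ℕ) : ℚ)) ≤
      ∏ i ∈ range (r * n), ((((M * n + 2 * i + 2 : ℕ) : ℚ)) / 2) ^ 2 := by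
  rw [← prod_mul_distrib]
  refine prod_le_prod (fun _ _ => by positivity) fun i _ => ?_
  push_cast [Nat.cast_sub hk]
  nlinarith [sq_nonneg ((k : ℚ) - ((M : ℚ) * n - k))]

/-- The central product: for even `M = 2M'`, `∏_{i<rn} ((Mn+2i+2)/2)² = ((M'n+rn)!/(M'n)!)²`. [this file] -/
theorem prod_central_two_mul (M' r n : ℕ) :
    ∏ i ∈ range (r * n), ((((2 * M' * n + 2 * i + 2 : ℕ) : ℚ)) / 2) ^ 2 =
      ((((M' * n + r * n)! : ℕ) : ℚ) / ((M' * n)! : ℚ)) ^ 2 := by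
  have key : ∀ N : ℕ, (((M' * n)! : ℚ)) * ∏ i ∈ range N, (((2 * M' * n + 2 * i + 2 : ℕ) : ℚ) / 2) =
      ((M' * n + N)! : ℚ) := by
    intro N
    induction N with
    | zero => simp
    | succ N ih =>
      rw [prod_range_succ, ← mul_assoc, ih, show M' * n + (N + 1) = (M' * n + N) + 1 by ring, Nat.factorial_succ]
      push_cast; ring
  have h0 : (((M' * n)! : ℚ)) ≠ 0 := by positivity
  rw [prod_pow]
  congr 1
  rw [eq_div_iff h0, mul_comm]
  exact key (r * n)

/-! ### The uniform bound -/

/-- The `k`-free bound for the centre size: `(Mn+2) · ∏_{i<rn} ((Mn+2i+2)/2)² / n!^{2r} · ∏_j 2^{(M−2δ_j)n}`. [this file] -/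
def laiGAbsBound (J r M n : ℕ) (δ : Fin J → ℕ) : ℚ :=
  (((M * n + 2 : ℕ) : ℚ)) * ((∏ i ∈ range (r * n), ((((M * n + 2 * i + 2 : ℕ) : ℚ)) / 2) ^ 2) / (n ! : ℚ) ^ (2 * r)) *
    ∏ j : Fin J, (2 : ℚ) ^ ((M - 2 * δ j) * n)

/-- `0 ≤ laiGAbsBound`. [folklore] -/
theorem laiGAbsBound_nonneg (J r M n : ℕ) (δ : Fin J → ℕ) : 0 ≤ laiGAbsBound J r M n δ := by
  unfold laiGAbsBound; positivity

/-- **`laiGAbs(k) ≤ laiGAbsBound`** for every pole index `0 ≤ k ≤ Mn`. [this file] -/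
theorem laiGAbs_le (J r M n : ℕ) (δ : Fin J → ℕ) {k : ℕ} (hk : k ≤ M * n) :
    laiGAbs J r M n δ k ≤ laiGAbsBound J r M n δ := by
  have hk' : ((k : ℕ) : ℚ) ≤ ((M * n : ℕ) : ℚ) := by exact_mod_cast hk
  push_cast at hk'
  have hlin : |2 * (-(k : ℚ)) + (M : ℚ) * n| + 2 ≤ ((M * n + 2 : ℕ) : ℚ) := by
    push_cast
    have : |2 * (-(k : ℚ)) + (M : ℚ) * n| ≤ (M : ℚ) * n :=
      abs_le.2 ⟨by linarith, by linarith [(Nat.cast_nonneg k : (0:ℚ) ≤ k)]⟩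
    linarith
  have hnum : (∏ q ∈ range r, |polyBrick (-((r * n : ℕ) : ℤ) + ((q * n : ℕ) : ℤ)) n (-(k : ℚ))|) *
      (∏ q ∈ range r, |polyBrick (((M * n + 1 + q * n : ℕ) : ℤ)) n (-(k : ℚ))|) ≤
      (∏ i ∈ range (r * n), ((((M * n + 2 * i + 2 : ℕ) : ℚ)) / 2) ^ 2) / (n ! : ℚ) ^ (2 * r) := by
    rw [prod_abs_polyBrick_left, prod_abs_polyBrick_right r M n hk, div_mul_div_comm, ← pow_add, ← two_mul]
    exact div_le_div_of_nonneg_right (prod_numerators_le_central r M n hk) (by positivity)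
  have hblk : ∏ j : Fin J, recipRegAbs (((δ j * n : ℕ) : ℤ)) ((M - 2 * δ j) * n + 1) (k : ℤ) ≤
      ∏ j : Fin J, (2 : ℚ) ^ ((M - 2 * δ j) * n) :=
    prod_le_prod (fun j _ => recipRegAbs_nonneg _ _ _) fun j _ => by
      simpa using recipRegAbs_le_two_pow (((δ j * n : ℕ) : ℤ)) ((M - 2 * δ j) * n + 1) (k : ℤ)
  have h2 : 0 ≤ (∏ q ∈ range r, |polyBrick (-((r * n : ℕ) : ℤ) + ((q * n : ℕ) : ℤ)) n (-(k : ℚ))|) *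
      (∏ q ∈ range r, |polyBrick (((M * n + 1 + q * n : ℕ) : ℤ)) n (-(k : ℚ))|) :=
    mul_nonneg (prod_nonneg fun _ _ => abs_nonneg _) (prod_nonneg fun _ _ => abs_nonneg _)
  have h3 : 0 ≤ ∏ j : Fin J, recipRegAbs (((δ j * n : ℕ) : ℤ)) ((M - 2 * δ j) * n + 1) (k : ℤ) :=
    prod_nonneg fun _ _ => recipRegAbs_nonneg _ _ _
  rw [laiGAbs, laiGAbsBound, mul_assoc (|2 * (-(k : ℚ)) + (M : ℚ) * n| + 2)]
  exact mul_le_mul (mul_le_mul hlin hnum h2 (by positivity)) hblk h3 (by positivity)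

/-- **Coefficient bound, uniform in the pole index**: `|C_n c_{s−1,k}| ≤ laiGAbsBound · laiGWidth^{J−s}` for any
partial-fraction data `c`, `1 ≤ s ≤ J`, `0 ≤ k ≤ Mn`. [cite: Lai2024BallRivoal, Lemma 5.4] (Leibniz form) -/
theorem abs_laiC_mul_pf_le_bound (J r M n : ℕ) (δ : Fin J → ℕ) (hδ : ∀ j, 2 * δ j ≤ M) (hM : 0 < M)
    {c : ℕ → ℕ → ℚ}
    (hc : ∀ t : ℚ, (∀ p : ℕ, p ≤ M * n → t + p + 1 ≠ 0) →
      BallRivoal.pfEval (M * n) J c t =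
        ((laiPoly J r M n δ).comp (Polynomial.X + Polynomial.C 1)).eval t / BallRivoal.poch (t + 1) (M * n + 1) ^ J)
    {k : ℕ} (hk : k ≤ M * n) {s : ℕ} (hs₁ : 1 ≤ s) (hsJ : s ≤ J) :
    |laiC J r M n δ * c (s - 1) k| ≤ laiGAbsBound J r M n δ * laiGWidth J r M n δ ^ (J - s) :=
  (abs_laiC_mul_pf_le J r M n δ hδ hM hc hk hs₁ hsJ).trans (mul_le_mul_of_nonneg_right (laiGAbs_le J r M n δ hk)
    (pow_nonneg (zero_le_one.trans (one_le_laiGWidth J r M n δ)) _))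

end

end Summit.KontsevichZagierPeriods.Zeta5Search
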